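import Summits.QuantumFields.BalabanUV.T4Continuum.Spine.NE2KingTransplant

/-!
# T⁴ programme, spine node NE2 (U1a) — THE KING TRANSPLANT: non-vacuity witness of the unit-layer assembly

Cell `pub-balaban`, unit `b2b-balaban-t4-ne2-p3` (literature-transplant route, skeleton `t4/skeletons/NE2-t4-ne2-p3.md`,
node-test aid (g2)).  A ONE-SITE toy tower `D k = (2 + 2^{−k})·I` on the index set `Unit` (pseudo-metric `d ≡ 0`, `B = 0`)
satisfies ALL leaves of `Spine/NE2KingTransplant.covarianceTowerRate_of_leaves` simultaneously with a rate `< 1`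
(`γ = 2`, `ρ = ρ_B = 0`, `C₁ = 3`, `κ = 0`, `ε = 1/2`, `r = 1/2`, `V = 1`), so the assembled `CovarianceTowerRate` and the
entrywise limit `covariance_entry_limit` FIRE end-to-end (`toy_covarianceTowerRate`, `toy_entry_limit`): the interface is
inhabited and the binders are jointly satisfiable — nothing more.  [folklore]; NOT a statement about Bałaban's operators;
NOT summit progress; spine 0/9.  HONEST DEPENDENCY: continuum YM on T⁴ ⇐ BetaPertH ∧ nine spine estimates (0/9 proved);
BetaPertH ⇐ (D1) ∧ (D4) ∧ CAP+tail; G-an2-4 gates asym, D1 and NE2/3/4.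
-/

noncomputable section

open Matrix Finset Real Filter Topology
open Literature.MathematicalPhysics.QuantumFieldTheory.Balaban1983to89.QGQInverse (Coercive)
open Literature.MathematicalPhysics.QuantumFieldTheory.King1986 (wRow wCol)
open Summit.QuantumFields.BalabanUV.T4Continuum.NE2KingTransplant

namespace Summit.QuantumFields.BalabanUV.T4Continuum.NE2KingTransplantWitness

/-- the toy tower `D k = (2 + 2^{−k})·I` on one site. [folklore] -/
def toyD (k : ℕ) : Matrix Unit Unit ℝ := (2 + (1 / 2 : ℝ) ^ k) • (1 : Matrix Unit Unit ℝ)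

/-- the trivial pseudo-metric on one site. [folklore] -/
def toyd : Unit → Unit → ℝ := fun _ _ => 0

/-- `d ≡ 0` is a pseudo-metric. [folklore] -/
theorem toyd_isPseudoMetric : IsPseudoMetric toyd :=
  ⟨fun _ _ => rfl, fun _ => rfl, fun _ _ _ => by simp [toyd]⟩

/-- entries of the toy tower. [folklore] -/
theorem toyD_apply (k : ℕ) (i j : Unit) : toyD k i j = 2 + (1 / 2 : ℝ) ^ k := by
  rw [toyD, Matrix.smul_apply, Matrix.one_apply, if_pos (Subsingleton.elim i j), smul_eq_mul, mul_one]

/-- (H1) for the toy tower: `D k + 0 ≥ 2`. [folklore] -/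
theorem toy_uniformCoercive : UniformCoercive toyD 0 2 := by
  intro k x
  have hx : x ⬝ᵥ ((toyD k + 0) *ᵥ x) = (2 + (1 / 2 : ℝ) ^ k) * (x ⬝ᵥ x) := by
    rw [add_zero, toyD, Matrix.smul_mulVec, Matrix.one_mulVec, dotProduct_smul, smul_eq_mul]
  rw [hx]
  have h0 : 0 ≤ x ⬝ᵥ x := by
    rw [dotProduct]; exact Finset.sum_nonneg fun i _ => mul_self_nonneg _
  have hp : 0 ≤ (1 / 2 : ℝ) ^ k := by positivity
  nlinarith

/-- (H2) for the toy tower: all weighted off-diagonal sums vanish (`d ≡ 0`). [folklore] -/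
theorem toy_uniformCTBound : UniformCTBound toyD 0 toyd 0 0 0 := by
  refine ⟨fun k i => ?_, fun k j => ?_, fun i => ?_, fun j => ?_⟩ <;>
    simp [wRow, wCol, toyd]

/-- (H2′) for the toy tower: `|D k z w| ≤ 3`. [folklore] -/
theorem toy_uniformKernelDecay : UniformKernelDecay toyD toyd 3 0 := by
  intro k z w
  rw [toyD_apply]
  have hp : 0 ≤ (1 / 2 : ℝ) ^ k := by positivity
  have hp1 : (1 / 2 : ℝ) ^ k ≤ 1 := pow_le_one₀ (by norm_num) (by norm_num)
  rw [abs_of_nonneg (by linarith)]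
  have e : (3 : ℝ) * Real.exp (-(2 * 0 * toyd z w)) = 3 := by simp [toyd]
  rw [e]
  linarith

/-- (H3) for the toy tower: `|D (k+1) − D k| = 2^{−(k+1)} ≤ (1/2)·(1/2)^k`. [folklore] -/
theorem toy_effectiveOperatorSupRate : EffectiveOperatorSupRate toyD (1 / 2) (1 / 2) := by
  intro k z w
  rw [Matrix.sub_apply, toyD_apply, toyD_apply]
  have e : 2 + (1 / 2 : ℝ) ^ (k + 1) - (2 + (1 / 2) ^ k) = -((1 / 2) * (1 / 2) ^ k) := by
    rw [pow_succ]; ring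
  rw [e, abs_neg, abs_of_nonneg (by positivity)]

/-- (H4) for the toy tower: `Σ_z e^0 = 1`. [folklore] -/
theorem toy_volumeSum : VolumeSum toyd 0 1 := by
  intro x
  simp [toyd]

/-- **THE ASSEMBLY FIRES** on the toy tower: King's (4.38) shape with rate `√(1/2) < 1` per step. [folklore] -/
theorem toy_covarianceTowerRate :
    CovarianceTowerRate toyD 0 toyd (Real.sqrt (1 / 2 * (2 * 3)) * ((2 - (0 + 0))⁻¹) ^ 2 * 1 ^ 2) (0 / 2)
      (Real.sqrt (1 / 2)) :=
  covarianceTowerRate_of_leaves toyD 0 toyd toyd_isPseudoMetric (by norm_num) le_rfl (by norm_num) (by norm_num)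
    toy_uniformCoercive toy_uniformCTBound toy_uniformKernelDecay toy_effectiveOperatorSupRate toy_volumeSum

/-- **and the entrywise limit follows** (the covariances `(D k)⁻¹ = (2 + 2^{−k})⁻¹` converge — here, to `1/2`).
[folklore] -/
theorem toy_entry_limit (x y : Unit) : ∃ ℓ : ℝ, Tendsto (fun k => (toyD k + 0)⁻¹ x y) atTop (𝓝 ℓ) := by
  have hs : Real.sqrt (1 / 2) < 1 := by
    rw [Real.sqrt_lt' one_pos]; norm_num
  have hC : (0 : ℝ) ≤ Real.sqrt (1 / 2 * (2 * 3)) * ((2 - (0 + 0))⁻¹) ^ 2 * 1 ^ 2 :=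
    mul_nonneg (mul_nonneg (Real.sqrt_nonneg _) (sq_nonneg _)) (sq_nonneg _)
  obtain ⟨ℓ, h, _⟩ := covariance_entry_limit (d := toyd) (κ' := 0 / 2) hC (Real.sqrt_nonneg _) hs
    (by norm_num) (fun _ _ => le_rfl) toy_covarianceTowerRate x y
  exact ⟨ℓ, h⟩

end Summit.QuantumFields.BalabanUV.T4Continuum.NE2KingTransplantWitness

end
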